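/-
Copyright: the pub-balaban-gaps cell (G2 seat ne6, gen 7; row NE7b), for the b2b-balaban T⁴-continuum CRUX team's
row-NE7b OWNER lineage `t4-ne7b-p1` (re-cut W-ne7bp1-g103-1 ∕ -2). Released under the licence of the surrounding project.
-/
import Summits.QuantumFields.BalabanUV.T4Continuum.Support.B16HistoryReprInstance

/-!
# PREFIX EXTRACTION: per-step RELATIVE event displays along a history tower give the K-step per-class partial-sum
# display by induction on the prefix — the healed ∕ unpinned content summed EXACTLY (row NE7b, node U5c; the METHOD
# named in owner ruling W-ne7bp1-g103-2 (2) and leaf-02 g117's (S2), typed as a kernel theorem over the abstract tower)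

Cell `pub-balaban`, sub-cell `t4`, spine estimate NE7b (`T4WeightBudget.RelWeightBound`, the cell's OWN estimate — NOT
PRINTED in [Bałaban 1983–89], NOT PROVED).  Crux-route work under `Spine/NE7b/` (like `…NE7b.PinnedExtraction`,
`…NE7b.StepKernelOps`); it types NO `T4Continuum/Support` leaf, mints no `Prop` of Bałaban's, carries no `[cite:]` tag;
zero `sorry`.  Imports the Support leaf `B16HistoryReprInstance` (the abstract history tower `B16HistoryReprChain.Tower`
of IR-97-2 and its telescoping lemma `Tower.integral_dens_eq_of_lt`) only.

WHY.  After the owner's located findings F-ne7bp1-g103-1∕2 (memo `t4/b2b-balaban-t4-ne7b-p1/g103/F-RHO-TOWER-g103.md`)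
the (α) road of row NE7b is re-cut at the per-pinned-class RELATIVE partial-sum display
`PinnedExtraction.ExtractionLaws.extract : Σ_{τ ∈ class x} A K t τ ≤ q K x · Σ_{T K} A K t τ` (p352727; IR-103-1's fields
`extractA ∕ extractB`), a K-STEP statement about the history expansion [Balaban1989LargeFieldII] (1.71)∕(1.72) p. 378
(LOCATOR) that print never states.  Ruling W-ne7bp1-g103-2 (2) names the METHOD by which an instance would prove it:
«class weights bounded by PREFIX INDUCTION with live-data-conditioned partial sums using `hunit` + `hκ`, healed content
summed EXACTLY as IR-102-1 telescopes `H2A`» (leaf-02 g117 `Q-G102-1-ESIDE-leaf02-g117.md` (S2): «what remains per step is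
the conditional partial sum over outcomes containing a key event ≤ (event factor) × (full step)»).  THIS FILE IS THAT
METHOD AS A THEOREM over the abstract tower `Tower P C 𝒢` (history-dependent branching `branch j g`, one positive additive
map `op j g p` per (history, choice), history terms `eterm ρ₀ K h`, levels measured by `μ j`): a PINNED PATTERN `S j g ⊆ P`
(the next choices that carry the pinned class's event at step `j` after the prefix `g`; all of `branch j g` at unpinned
steps) cuts out the pattern class `admS T S K ⊆ adm K`, and ONE-STEP RELATIVE displays
  `hrel : Σ_{p ∈ branch j g ∩ S j g} ∫ (op j g p)(eterm j g) dμ_{j+1} ≤ ε j · ∫ eterm j g dμ_j`   (pattern prefixes `g` only)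
give `Σ_{h ∈ admS K} ∫ eterm K h dμ_K ≤ (Π_{j<K} ε j) · ∫ ρ₀ dμ_0` BY INDUCTION ON THE PREFIX — no integrability, no
envelope, no sup letter: the display divides two integrals of the same term, so every normalisation (the bare-field
entropy `1∕Z_K` of F-g103-2, the dead large-field gas of F-g103-1, vacuum energies) cancels.  At an UNPINNED step the
display holds with `ε j = 1` by the termwise integral preservation `hpres` (the decomposition of unity + the per-(step,
choice) integral identity — IR-102-1's `hunit` + `hstep`, [Balaban1989LargeFieldI] (0.4) p. 176, (1.3)–(1.9) p. 178,
LOCATORS): the healed ∕ free content is summed exactly.  With the telescoping `∫ ρ₀ dμ_0 = Σ_{h ∈ adm K} ∫ eterm K h dμ_K`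
this IS the relative display with quotient `Π_{pinned j} ε j`.  §4 adds print's OTHER reading of the same cut (memo g103
§3 (ii): «the UV-stability upper half run with the pinned genealogy's operations replaced by their (1.79)∕(1.89) bounds»):
TERMWISE DOMINATION of each history term's one-step image by its image under a comparison tower `T⁺`, with per-(step,
history, choice) factors `c j g p`, gives
`eterm_T K h ≤ (wAlong c K h) · eterm_{T⁺} K h` pointwise and the pattern class's ABSOLUTE numerator bound against the
comparison tower's total — the `hnum` of `PinnedExtraction.ExtractionLaws.ofAbsolute`, whose `Nup` is then a TOTAL
(`∫ dens_{T⁺} K dμ_K`), not a sup letter.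

WHAT IS PROVED ([folklore]; finite sums, Bochner monotonicity; nothing of Bałaban's named):
* §1 `admS T S K` (the pattern class, recursive like `Tower.adm`), `mem_admS_succ`, `admS_subset_adm`, `sum_admS_succ`,
  `admS_mono`, `admS_eq_adm_of_forall` (no pinning ⟹ the whole class), `eterm_snoc`.
* §2 **`sum_admS_integral_le`** (THE PREFIX INDUCTION: `hrel` at the pattern prefixes of the levels `j < K`, `0 ≤ ε` ⟹
  `Σ_{admS K} ∫ eterm ≤ (Π_{j<K} ε j)·∫ρ₀ dμ_0`); **`sum_admS_integral_le_mul_sum_adm`** (+ the telescoping displays ⟹ the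
  RELATIVE form `≤ (Π ε)·Σ_{adm K} ∫ eterm`); `hrel_one_of_hpres` (unpinned step: `ε = 1` from `hpres`);
  **`sum_admS_integral_le_prod_filter`** (pinned levels `J`: displays on `J`, `hpres` off `J` ⟹ quotient `Π_{j ∈ J, j<K} ε j`);
  `hrel_of_hstep` (the display in IR-102-1's `hstep` currency: an IN-MEASURE event bound `∫ χ_S·eterm dμ_j ≤ ε·∫ eterm dμ_j`
  under the term's own level-`j` measure).
* §3 `integral_eterm_nonneg`, `sum_admS_integral_le_sum_adm` (ε ≤ 1 everywhere ⟹ the class is at most the whole).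
* §4 **`eterm_le_wAlong_mul_eterm`** (termwise domination `op (eterm j g) ≤ c·op⁺ (eterm j g)` AT THE HISTORY TERM, asked at the
  admissible (level `< K`, history, choice) triples only ⟹ `eterm_T ≤ wAlong c · eterm_{T⁺}` on admissible histories); `admS_subset_admS`;
  **`sum_admS_integral_le_mul_sum_comparison`** (pattern factors `wAlong c K h ≤ q` on the class + `branch ⊆
  branch⁺` ⟹ `Σ_{admS K} ∫ eterm_T ≤ q · Σ_{adm⁺ K} ∫ eterm_{T⁺}` = the numerator `hnum` of the absolute architecture with
  `Nup` the comparison TOTAL).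

NOT HERE (honest).  The displays themselves for Bałaban's tower: `hrel` per (pinned step, prefix) is [B16] (1.79) p. 383's
KIND read IN MEASURE («a new large-field event of the pinned genealogy costs `e^{−p₀(g_j)+…}` RELATIVE to the same term's
full step») — NOT print's statement (print routes the comparison through operations with RELAXED constants, (1.79)–(1.80),
whose K-step total is the UV-stability upper bound: that is §4's reading, with the envelope ratio `Nup ≤ R·floor` of
`ExtractionLaws.ofAbsolute` still owed K-uniformly — at fixed volume, the GD price); the cover (which patterns the bad
class's pinned genealogies cut out: the R-class reading, (A1c)); the count `Σ_x Π ε ≤ V·r^{K−j⋆(K)}` (the cell's banking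
arithmetic).  BY-NAME EFFECT ON THE WALL: the K-step display `extract` is DERIVED from ONE-STEP displays of print's kind —
a reduction of what the (A1c) instance owes per pinned class from a K-step partial-sum statement to per-step ones; nothing
is discharged.  NE7b NOT PRINTED ∕ NOT PROVED; spine PROVED 0∕9; rung (B)+1 on a FINITE torus — NOT infinite volume, NOT
the mass gap, NOT Clay.
HONEST DEPENDENCY: continuum YM on T⁴ ⇐ BetaPertH ∧ nine spine estimates (0/9 proved); BetaPertH ⇐ (D1) ∧ (D4) ∧
CAP+tail; G-an2-4 gates asym, D1 and NE2/3/4.  This file changes none of it.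
-/

set_option autoImplicit false

open Finset MeasureTheory
open Summit.QuantumFields.BalabanUV.T4Continuum.B16HistoryIndexedRepr
open Summit.QuantumFields.BalabanUV.T4Continuum.B16HistoryReprChain

namespace Summit.QuantumFields.BalabanUV.T4Continuum.NE7b.PrefixExtraction

variable {P : Type} [DecidableEq P] {C : ℕ → Type} {𝒢 : (j : ℕ) → GoodClass (C j)}

/-! ## §1 Pinned patterns on a history tower and the class they cut out -/

section Pattern

variable (T : Tower P C 𝒢) (S : (j : ℕ) → (Fin j → P) → Finset P)

/-- **THE PATTERN CLASS** of the pinned pattern `S` (after the prefix `g` of `j` steps, the next choices `S j g` carry the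
pinned class's step-`j` content; `S j g ⊇ branch j g` at an unpinned step): the admissible histories of length `K` whose
every choice lies in the pattern — the empty history; a pattern history of length `K` followed by an admissible next choice
in `S K g`. [folklore] -/
def admS : (K : ℕ) → Finset (Fin K → P)
  | 0 => Finset.univ
  | K + 1 => ((admS K).sigma fun g => T.branch K g ∩ S K g).map ⟨_, Tower.snoc_injective (P := P) K⟩

/-- Membership one level up: the initial segment is a pattern history and the last choice is an admissible next choice in
the pattern. [folklore] -/
theorem mem_admS_succ {K : ℕ} (h : Fin (K + 1) → P) :
    h ∈ admS T S (K + 1) ↔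
      Fin.init h ∈ admS T S K ∧ h (Fin.last K) ∈ T.branch K (Fin.init h) ∧ h (Fin.last K) ∈ S K (Fin.init h) := by
  show h ∈ ((admS T S K).sigma fun g => T.branch K g ∩ S K g).map ⟨_, Tower.snoc_injective (P := P) K⟩ ↔ _
  rw [Finset.mem_map]
  constructor
  · rintro ⟨⟨g, p⟩, hgp, rfl⟩
    rw [Finset.mem_sigma, Finset.mem_inter] at hgp
    simpa [Fin.init_snoc, Fin.snoc_last] using hgp
  · rintro ⟨hg, hb, hs⟩
    exact ⟨⟨Fin.init h, h (Fin.last K)⟩, Finset.mem_sigma.mpr ⟨hg, Finset.mem_inter.mpr ⟨hb, hs⟩⟩,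
      Fin.snoc_init_self h⟩

/-- The pattern class consists of admissible histories. [folklore] -/
theorem admS_subset_adm : ∀ K, admS T S K ⊆ T.adm K
  | 0 => fun _ _ => Finset.mem_univ _
  | K + 1 => fun h hh => by
      obtain ⟨hg, hb, -⟩ := (mem_admS_succ T S h).1 hh
      exact (T.mem_adm_succ h).2 ⟨admS_subset_adm K hg, hb⟩

/-- Splitting the LAST choice off a sum over the pattern class of length `K + 1`. [folklore] -/
theorem sum_admS_succ {M : Type*} [AddCommMonoid M] (K : ℕ) (F : (Fin (K + 1) → P) → M) :
    ∑ h ∈ admS T S (K + 1), F h = ∑ g ∈ admS T S K, ∑ p ∈ T.branch K g ∩ S K g, F (Fin.snoc g p) := by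
  show ∑ h ∈ ((admS T S K).sigma fun g => T.branch K g ∩ S K g).map ⟨_, Tower.snoc_injective (P := P) K⟩, F h = _
  rw [Finset.sum_map, Finset.sum_sigma]
  rfl

variable {T S}

/-- A wider pattern cuts out a larger class. [folklore] -/
theorem admS_mono {S' : (j : ℕ) → (Fin j → P) → Finset P} (hS : ∀ j g, S j g ⊆ S' j g) :
    ∀ K, admS T S K ⊆ admS T S' K
  | 0 => fun _ _ => Finset.mem_univ _
  | K + 1 => fun h hh => by
      obtain ⟨hg, hb, hs⟩ := (mem_admS_succ T S h).1 hh
      exact (mem_admS_succ T S' h).2 ⟨admS_mono hS K hg, hb, hS K _ hs⟩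

/-- NO PINNING: a pattern admitting every admissible choice cuts out the whole class of admissible histories. [folklore] -/
theorem admS_eq_adm_of_forall (hS : ∀ j g, T.branch j g ⊆ S j g) : ∀ K, admS T S K = T.adm K
  | 0 => rfl
  | K + 1 => by
      ext h
      rw [mem_admS_succ, T.mem_adm_succ, admS_eq_adm_of_forall hS K]
      exact ⟨fun ⟨hg, hb, _⟩ => ⟨hg, hb⟩, fun ⟨hg, hb⟩ => ⟨hg, hb, hS K _ hb⟩⟩

variable (T)

omit [DecidableEq P] in
/-- The history term one level up, at an appended choice: `eterm (K+1) (g, p) = op_K(g, p) (eterm K g)`. [folklore] -/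
theorem eterm_snoc (ρ₀ : C 0 → ℝ) (K : ℕ) (g : Fin K → P) (p : P) :
    T.eterm ρ₀ (K + 1) (Fin.snoc g p) = (T.op K g p).T (T.eterm ρ₀ K g) := by
  simp [Tower.eterm, Fin.init_snoc, Fin.snoc_last]

end Pattern

/-! ## §2 THE PREFIX INDUCTION: one-step relative displays at the pattern prefixes ⟹ the K-step partial-sum display -/

section Prefix

variable (T : Tower P C 𝒢) (S : (j : ℕ) → (Fin j → P) → Finset P) [∀ j, MeasurableSpace (C j)]
  (μ : (j : ℕ) → Measure (C j)) (ρ₀ : C 0 → ℝ) (ε : ℕ → ℝ)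

/-- **THE PREFIX INDUCTION.**  If at every level `j < K`, after every PATTERN prefix `g`, the one-step images of the history
term along the pattern's next choices have total `μ_{j+1}`-integral at most `ε j` times the term's `μ_j`-integral (display
`hrel`; `0 ≤ ε`), then the pattern class's total weight at level `K` is at most `(Π_{j<K} ε j) · ∫ ρ₀ dμ_0`.  Induction on the
prefix; no integrability, no envelope, no sup letter. [folklore] -/
theorem sum_admS_integral_le (hε : ∀ j, 0 ≤ ε j) :
    ∀ K, (∀ j g, j < K → g ∈ admS T S j →
        ∑ p ∈ T.branch j g ∩ S j g, ∫ x, (T.op j g p).T (T.eterm ρ₀ j g) x ∂μ (j + 1) ≤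
          ε j * ∫ x, T.eterm ρ₀ j g x ∂μ j) →
      ∑ h ∈ admS T S K, ∫ x, T.eterm ρ₀ K h x ∂μ K ≤ (∏ j ∈ Finset.range K, ε j) * ∫ x, ρ₀ x ∂μ 0
  | 0, _ => by
      show ∑ h ∈ (Finset.univ : Finset (Fin 0 → P)), ∫ x, ρ₀ x ∂μ 0 ≤ _
      rw [Finset.univ_unique, Finset.sum_singleton, Finset.prod_range_zero, one_mul]
  | K + 1, hrel => by
      rw [sum_admS_succ, Finset.prod_range_succ]
      have e : ∀ g ∈ admS T S K, ∑ p ∈ T.branch K g ∩ S K g, ∫ x, T.eterm ρ₀ (K + 1) (Fin.snoc g p) x ∂μ (K + 1) =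
          ∑ p ∈ T.branch K g ∩ S K g, ∫ x, (T.op K g p).T (T.eterm ρ₀ K g) x ∂μ (K + 1) :=
        fun g _ => Finset.sum_congr rfl fun p _ => by rw [eterm_snoc]
      rw [Finset.sum_congr rfl e]
      calc ∑ g ∈ admS T S K, ∑ p ∈ T.branch K g ∩ S K g, ∫ x, (T.op K g p).T (T.eterm ρ₀ K g) x ∂μ (K + 1)
          ≤ ∑ g ∈ admS T S K, ε K * ∫ x, T.eterm ρ₀ K g x ∂μ K :=
            Finset.sum_le_sum fun g hg => hrel K g K.lt_succ_self hg
        _ = ε K * ∑ g ∈ admS T S K, ∫ x, T.eterm ρ₀ K g x ∂μ K := (Finset.mul_sum _ _ _).symm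
        _ ≤ ε K * ((∏ j ∈ Finset.range K, ε j) * ∫ x, ρ₀ x ∂μ 0) :=
            mul_le_mul_of_nonneg_left
              (sum_admS_integral_le hε K fun j g hj => hrel j g (Nat.lt_succ_of_lt hj)) (hε K)
        _ = (∏ j ∈ Finset.range K, ε j) * ε K * ∫ x, ρ₀ x ∂μ 0 := by ring

/-- **THE RELATIVE FORM.**  With the telescoping displays of `Tower.integral_dens_eq_of_lt` (termwise integral preservation
`hpres` and the two integrability displays at the levels `j < K`) and integrable level-`K` terms, `∫ ρ₀ dμ_0` IS the full
level-`K` sum, so the prefix induction reads: the pattern class's partial sum is at most `(Π_{j<K} ε j)` times the FULL sum —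
the display `PinnedExtraction.ExtractionLaws.extract` for this class, with that quotient. [folklore] -/
theorem sum_admS_integral_le_mul_sum_adm (hε : ∀ j, 0 ≤ ε j) (K : ℕ)
    (hrel : ∀ j g, j < K → g ∈ admS T S j →
      ∑ p ∈ T.branch j g ∩ S j g, ∫ x, (T.op j g p).T (T.eterm ρ₀ j g) x ∂μ (j + 1) ≤
        ε j * ∫ x, T.eterm ρ₀ j g x ∂μ j)
    (hint : ∀ j g, j < K → g ∈ T.adm j → Integrable (T.eterm ρ₀ j g) (μ j))
    (hint' : ∀ j g p, j < K → g ∈ T.adm j → p ∈ T.branch j g →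
      Integrable ((T.op j g p).T (T.eterm ρ₀ j g)) (μ (j + 1)))
    (hpres : ∀ j g, j < K → g ∈ T.adm j →
      ∫ x, (∑ p ∈ T.branch j g, (T.op j g p).T (T.eterm ρ₀ j g) x) ∂μ (j + 1) = ∫ x, T.eterm ρ₀ j g x ∂μ j)
    (hintK : ∀ h ∈ T.adm K, Integrable (T.eterm ρ₀ K h) (μ K)) :
    ∑ h ∈ admS T S K, ∫ x, T.eterm ρ₀ K h x ∂μ K ≤
      (∏ j ∈ Finset.range K, ε j) * ∑ h ∈ T.adm K, ∫ x, T.eterm ρ₀ K h x ∂μ K := by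
  have htot : ∑ h ∈ T.adm K, ∫ x, T.eterm ρ₀ K h x ∂μ K = ∫ x, ρ₀ x ∂μ 0 := by
    rw [← integral_finsetSum _ hintK]
    exact T.integral_dens_eq_of_lt μ ρ₀ K hint hint' hpres
  rw [htot]
  exact sum_admS_integral_le T S μ ρ₀ ε hε K hrel

variable {T S μ ρ₀}

/-- **AN UNPINNED STEP COSTS NOTHING**: where the pattern admits every admissible next choice, termwise integral preservation
(`hpres`, from the decomposition of unity + the per-(step, choice) integral identity) and integrability of the one-step
images give the display with `ε = 1` — the healed ∕ free content of that step is summed EXACTLY. [folklore] -/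
theorem hrel_one_of_hpres {j : ℕ} {g : Fin j → P} (hS : T.branch j g ⊆ S j g)
    (hint' : ∀ p ∈ T.branch j g, Integrable ((T.op j g p).T (T.eterm ρ₀ j g)) (μ (j + 1)))
    (hpres : ∫ x, (∑ p ∈ T.branch j g, (T.op j g p).T (T.eterm ρ₀ j g) x) ∂μ (j + 1) =
      ∫ x, T.eterm ρ₀ j g x ∂μ j) :
    ∑ p ∈ T.branch j g ∩ S j g, ∫ x, (T.op j g p).T (T.eterm ρ₀ j g) x ∂μ (j + 1) ≤
      1 * ∫ x, T.eterm ρ₀ j g x ∂μ j := by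
  rw [Finset.inter_eq_left.2 hS, one_mul, ← integral_finsetSum _ hint', hpres]

variable (T S μ ρ₀)

/-- **PINNED LEVELS ONLY.**  If the pattern pins the levels of a set `J` — the display `hrel` with rate `ε j` at the pattern
prefixes of every pinned level `j < K`, and NO restriction (`branch j g ⊆ S j g`) at the other levels, where termwise integral
preservation holds — then the pattern class's weight is at most `(Π_{j ∈ J, j < K} ε j) · ∫ ρ₀ dμ_0`. [folklore] -/
theorem sum_admS_integral_le_prod_filter (J : Finset ℕ) (hε : ∀ j ∈ J, 0 ≤ ε j) (K : ℕ)
    (hpin : ∀ j g, j < K → j ∈ J → g ∈ admS T S j →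
      ∑ p ∈ T.branch j g ∩ S j g, ∫ x, (T.op j g p).T (T.eterm ρ₀ j g) x ∂μ (j + 1) ≤
        ε j * ∫ x, T.eterm ρ₀ j g x ∂μ j)
    (hfree : ∀ j g, j < K → j ∉ J → T.branch j g ⊆ S j g)
    (hint' : ∀ j g p, j < K → j ∉ J → g ∈ T.adm j → p ∈ T.branch j g →
      Integrable ((T.op j g p).T (T.eterm ρ₀ j g)) (μ (j + 1)))
    (hpres : ∀ j g, j < K → j ∉ J → g ∈ T.adm j →
      ∫ x, (∑ p ∈ T.branch j g, (T.op j g p).T (T.eterm ρ₀ j g) x) ∂μ (j + 1) = ∫ x, T.eterm ρ₀ j g x ∂μ j) :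
    ∑ h ∈ admS T S K, ∫ x, T.eterm ρ₀ K h x ∂μ K ≤
      (∏ j ∈ (Finset.range K).filter (· ∈ J), ε j) * ∫ x, ρ₀ x ∂μ 0 := by
  have hε' : ∀ j, 0 ≤ (if j ∈ J then ε j else 1) := fun j => by
    split_ifs with hj
    · exact hε j hj
    · exact zero_le_one
  have h := sum_admS_integral_le T S μ ρ₀ (fun j => if j ∈ J then ε j else 1) hε' K fun j g hj hg => by
    by_cases hJ : j ∈ J
    · rw [if_pos hJ]; exact hpin j g hj hJ hg
    · rw [if_neg hJ]
      exact hrel_one_of_hpres (hfree j g hj hJ)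
        (fun p hp => hint' j g p hj hJ (admS_subset_adm T S j hg) hp) (hpres j g hj hJ (admS_subset_adm T S j hg))
  rwa [Finset.prod_ite, Finset.prod_const_one, mul_one] at h

variable {T S μ ρ₀}

/-- **THE DISPLAY IN THE `hstep` CURRENCY** (IR-102-1): if every one-step image carries the per-(step, choice) integral identity
`∫ (op j g p) f dμ_{j+1} = ∫ χ_{j,g,p}·f dμ_j` for good `f`, then `hrel` at the prefix `g` IS the IN-MEASURE event bound
`∫ (Σ_{p ∈ branch ∩ S} χ_{j,g,p})·eterm j g dμ_j ≤ ε j·∫ eterm j g dμ_j` — the pinned event's characteristic functions have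
relative mass `≤ ε j` under the term's OWN level-`j` measure `eterm j g · μ_j`. [folklore] -/
theorem hrel_of_hstep {ρ₀ : C 0 → ℝ} (hρ : (𝒢 0).Gd ρ₀) {j : ℕ} {g : Fin j → P} {e : ℝ}
    (χ : P → C j → ℝ)
    (hstep : ∀ p ∈ T.branch j g, ∀ f : C j → ℝ, (𝒢 j).Gd f →
      ∫ x, (T.op j g p).T f x ∂μ (j + 1) = ∫ y, χ p y * f y ∂μ j)
    (hintχ : ∀ p ∈ T.branch j g, Integrable (fun y => χ p y * T.eterm ρ₀ j g y) (μ j))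
    (hχ : ∫ y, (∑ p ∈ T.branch j g ∩ S j g, χ p y) * T.eterm ρ₀ j g y ∂μ j ≤ e * ∫ y, T.eterm ρ₀ j g y ∂μ j) :
    ∑ p ∈ T.branch j g ∩ S j g, ∫ x, (T.op j g p).T (T.eterm ρ₀ j g) x ∂μ (j + 1) ≤
      e * ∫ x, T.eterm ρ₀ j g x ∂μ j := by
  have hsub : T.branch j g ∩ S j g ⊆ T.branch j g := Finset.inter_subset_left
  rw [Finset.sum_congr rfl fun p hp => hstep p (hsub hp) _ (T.eterm_good hρ j g)]
  rw [← integral_finsetSum _ fun p hp => hintχ p (hsub hp)]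
  refine le_of_eq_of_le (integral_congr_ae (Filter.Eventually.of_forall fun y => ?_)) hχ
  show ∑ p ∈ T.branch j g ∩ S j g, χ p y * T.eterm ρ₀ j g y = (∑ p ∈ T.branch j g ∩ S j g, χ p y) * T.eterm ρ₀ j g y
  rw [Finset.sum_mul]

end Prefix

/-! ## §3 Sanity of the currency: rates at most one give a class at most the whole -/

section Mono

variable (T : Tower P C 𝒢) [∀ j, MeasurableSpace (C j)] (μ : (j : ℕ) → Measure (C j)) {ρ₀ : C 0 → ℝ}

omit [DecidableEq P] in
/-- History terms of a good non-negative `ρ₀` have non-negative integrals. [folklore] -/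
theorem integral_eterm_nonneg (hρ : (𝒢 0).Gd ρ₀) (h0 : ∀ x, 0 ≤ ρ₀ x) (K : ℕ) (h : Fin K → P) :
    0 ≤ ∫ x, T.eterm ρ₀ K h x ∂μ K :=
  integral_nonneg fun x => T.eterm_nonneg hρ h0 K h x

/-- The pattern class's partial sum is at most the full sum (non-negative terms; no display needed). [folklore] -/
theorem sum_admS_integral_le_sum_adm (S : (j : ℕ) → (Fin j → P) → Finset P) (hρ : (𝒢 0).Gd ρ₀)
    (h0 : ∀ x, 0 ≤ ρ₀ x) (K : ℕ) :
    ∑ h ∈ admS T S K, ∫ x, T.eterm ρ₀ K h x ∂μ K ≤ ∑ h ∈ T.adm K, ∫ x, T.eterm ρ₀ K h x ∂μ K :=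
  Finset.sum_le_sum_of_subset_of_nonneg (admS_subset_adm T S K) fun h _ _ => integral_eterm_nonneg T μ hρ h0 K h

end Mono

/-! ## §4 Print's other reading of the cut: termwise domination by a comparison tower -/

section Comparison

variable (T T' : Tower P C 𝒢) {ρ₀ : C 0 → ℝ} (c : (j : ℕ) → (Fin j → P) → P → ℝ)

omit [DecidableEq P] in
/-- **TERMWISE DOMINATION ITERATES ALONG THE HISTORY.**  If the one-step image of every ADMISSIBLE history's OWN term (level
`j < K`, admissible next choice) under `T` is dominated pointwise by `c j g p` times its image under the corresponding step map
of the comparison tower `T⁺` (display `hdom`, asked AT THE HISTORY TERM `eterm ρ₀ j g` only — not for arbitrary good inputs: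
a large-field characteristic function is small against THAT term's density, not as an operator — and on the admissible (level,
history, choice) triples below the cutoff only: the pinned genealogy's operations «replaced by their bounds», `c = e^{−p₀(g_j)+…}`
at its events and `1` elsewhere — [Balaban1989LargeFieldII] (1.79)–(1.80) p. 383–384's KIND, nothing asserted), then
`eterm_T K h ≤ (wAlong c K h) · eterm_{T⁺} K h` pointwise for every admissible history `h` of length `K`. [folklore] -/
theorem eterm_le_wAlong_mul_eterm (hρ : (𝒢 0).Gd ρ₀) (hc : ∀ j g p, 0 ≤ c j g p) :
    ∀ (K : ℕ), (∀ j g p, j < K → g ∈ T.adm j → p ∈ T.branch j g →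
        ∀ x, (T.op j g p).T (T.eterm ρ₀ j g) x ≤ c j g p * (T'.op j g p).T (T.eterm ρ₀ j g) x) →
      ∀ h ∈ T.adm K, ∀ x : C K, T.eterm ρ₀ K h x ≤ Tower.wAlong c K h * T'.eterm ρ₀ K h x
  | 0, _, _, _, x => by
      show ρ₀ x ≤ 1 * ρ₀ x
      rw [one_mul]
  | K + 1, hdom, h, hh, x => by
      obtain ⟨hg₀, hb⟩ := (T.mem_adm_succ h).1 hh
      have ih : ∀ y, T.eterm ρ₀ K (Fin.init h) y ≤ Tower.wAlong c K (Fin.init h) * T'.eterm ρ₀ K (Fin.init h) y :=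
        eterm_le_wAlong_mul_eterm hρ hc K (fun j g p hj => hdom j g p (Nat.lt_succ_of_lt hj)) (Fin.init h) hg₀
      have hg : (𝒢 K).Gd (T.eterm ρ₀ K (Fin.init h)) := T.eterm_good hρ K _
      have hg' : (𝒢 K).Gd (T'.eterm ρ₀ K (Fin.init h)) := T'.eterm_good hρ K _
      have hgw : (𝒢 K).Gd fun y => Tower.wAlong c K (Fin.init h) * T'.eterm ρ₀ K (Fin.init h) y := (𝒢 K).smul _ hg'
      show (T.op K (Fin.init h) (h (Fin.last K))).T (T.eterm ρ₀ K (Fin.init h)) x ≤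
        Tower.wAlong c K (Fin.init h) * c K (Fin.init h) (h (Fin.last K)) *
          (T'.op K (Fin.init h) (h (Fin.last K))).T (T'.eterm ρ₀ K (Fin.init h)) x
      calc (T.op K (Fin.init h) (h (Fin.last K))).T (T.eterm ρ₀ K (Fin.init h)) x
          ≤ c K (Fin.init h) (h (Fin.last K)) *
              (T'.op K (Fin.init h) (h (Fin.last K))).T (T.eterm ρ₀ K (Fin.init h)) x :=
            hdom K _ _ K.lt_succ_self hg₀ hb x
        _ ≤ c K (Fin.init h) (h (Fin.last K)) *
              (T'.op K (Fin.init h) (h (Fin.last K))).T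
                (fun y => Tower.wAlong c K (Fin.init h) * T'.eterm ρ₀ K (Fin.init h) y) x :=
            mul_le_mul_of_nonneg_left ((T'.op K _ _).mono hg hgw ih x) (hc K _ _)
        _ = Tower.wAlong c K (Fin.init h) * c K (Fin.init h) (h (Fin.last K)) *
              (T'.op K (Fin.init h) (h (Fin.last K))).T (T'.eterm ρ₀ K (Fin.init h)) x := by
            rw [(T'.op K _ _).smul hg']
            ring

/-- For the same pattern, a tower with fewer admissible choices has the smaller pattern class. [folklore] -/
theorem admS_subset_admS (S : (j : ℕ) → (Fin j → P) → Finset P) (hbr : ∀ j g, T.branch j g ⊆ T'.branch j g) :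
    ∀ K, admS T S K ⊆ admS T' S K
  | 0 => fun _ _ => Finset.mem_univ _
  | K + 1 => fun h hh => by
      obtain ⟨hg, hb, hs⟩ := (mem_admS_succ T S h).1 hh
      exact (mem_admS_succ T' S h).2 ⟨admS_subset_admS S hbr K hg, hbr K _ hb, hs⟩

variable [∀ j, MeasurableSpace (C j)] (μ : (j : ℕ) → Measure (C j))

/-- **THE ABSOLUTE NUMERATOR AGAINST THE COMPARISON TOTAL.**  Termwise domination (`hdom`), a pattern whose class forces the
product of factors below `q` (`hq : wAlong c K h ≤ q` on `admS T S K`, `0 ≤ q`), `branch ⊆ branch⁺`, and integrable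
comparison terms give `Σ_{h ∈ admS K} ∫ eterm_T K h dμ_K ≤ q · Σ_{h ∈ adm⁺ K} ∫ eterm_{T⁺} K h dμ_K` — the per-class
ABSOLUTE numerator bound `hnum` of `PinnedExtraction.ExtractionLaws.ofAbsolute` with `Nup :=` the comparison tower's level-`K`
TOTAL (a K-step integral, `= ∫ ρ₀ dμ_0` whenever `T⁺` also preserves integrals termwise), NOT a sup letter; the envelope ratio
`Nup ≤ R·floor` stays owed. [folklore] -/
theorem sum_admS_integral_le_mul_sum_comparison (S : (j : ℕ) → (Fin j → P) → Finset P)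
    (hρ : (𝒢 0).Gd ρ₀) (h0 : ∀ x, 0 ≤ ρ₀ x) (hc : ∀ j g p, 0 ≤ c j g p) (K : ℕ)
    (hdom : ∀ j g p, j < K → g ∈ T.adm j → p ∈ T.branch j g →
      ∀ x, (T.op j g p).T (T.eterm ρ₀ j g) x ≤ c j g p * (T'.op j g p).T (T.eterm ρ₀ j g) x)
    (hbr : ∀ j g, T.branch j g ⊆ T'.branch j g) {q : ℝ} (hq0 : 0 ≤ q)
    (hq : ∀ h ∈ admS T S K, Tower.wAlong c K h ≤ q)
    (hint : ∀ h ∈ T'.adm K, Integrable (T'.eterm ρ₀ K h) (μ K)) :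
    ∑ h ∈ admS T S K, ∫ x, T.eterm ρ₀ K h x ∂μ K ≤ q * ∑ h ∈ T'.adm K, ∫ x, T'.eterm ρ₀ K h x ∂μ K := by
  have hsub : admS T S K ⊆ T'.adm K := (admS_subset_admS T T' S hbr K).trans (admS_subset_adm T' S K)
  have h0' : ∀ h, 0 ≤ ∫ x, T'.eterm ρ₀ K h x ∂μ K := fun h => integral_nonneg fun x => T'.eterm_nonneg hρ h0 K h x
  calc ∑ h ∈ admS T S K, ∫ x, T.eterm ρ₀ K h x ∂μ K
      ≤ ∑ h ∈ admS T S K, ∫ x, Tower.wAlong c K h * T'.eterm ρ₀ K h x ∂μ K :=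
        Finset.sum_le_sum fun h hh =>
          integral_mono_of_nonneg (Filter.Eventually.of_forall fun x => T.eterm_nonneg hρ h0 K h x)
            ((hint h (hsub hh)).const_mul _)
            (Filter.Eventually.of_forall fun x =>
              eterm_le_wAlong_mul_eterm T T' c hρ hc K hdom h (admS_subset_adm T S K hh) x)
    _ = ∑ h ∈ admS T S K, Tower.wAlong c K h * ∫ x, T'.eterm ρ₀ K h x ∂μ K :=
        Finset.sum_congr rfl fun h _ => integral_const_mul _ _
    _ ≤ ∑ h ∈ admS T S K, q * ∫ x, T'.eterm ρ₀ K h x ∂μ K :=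
        Finset.sum_le_sum fun h hh => mul_le_mul_of_nonneg_right (hq h hh) (h0' h)
    _ = q * ∑ h ∈ admS T S K, ∫ x, T'.eterm ρ₀ K h x ∂μ K := (Finset.mul_sum _ _ _).symm
    _ ≤ q * ∑ h ∈ T'.adm K, ∫ x, T'.eterm ρ₀ K h x ∂μ K :=
        mul_le_mul_of_nonneg_left (Finset.sum_le_sum_of_subset_of_nonneg hsub fun h _ _ => h0' h) hq0

end Comparison

end Summit.QuantumFields.BalabanUV.T4Continuum.NE7b.PrefixExtraction
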